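import Mathlib

/-!
# `NewtonUnitEquationsNewtonTauWeakCoreRelabel` — the cloud of a `c`-core design is invariant under relabelling cores

Line `binomial-normal-form` of crux `NewtonTauWeak` (stmt-ValiantsHypothesis-5904), lead c7, stub P13.  A design on
`c` cores is `h : Fin c → Finset (Fin x) → ℕ²` (costs in `ℕ²`, written `Fin 2 →₀ ℕ`); a configuration
`f : Fin x → Fin c` (attached element `u` joins core `f u`), read through a window `V ⊆ [x]`, has the point
`Σ_d h d (V ∩ f⁻¹ d)`.  Relabelling the cores along an equivalence `e : Fin c' ≃ Fin c` (design `d ↦ h (e d)`,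
configurations into `Fin c'`) gives the same finite cloud of points.

Proof.  For `f : Fin x → Fin c'` the configuration `e ∘ f : Fin x → Fin c` has the same point: reindex
`Σ_{d : Fin c}` along `e` (`Fintype.sum_equiv`) and identify the fibres `{u | e (f u) = e d'} = {u | f u = d'}` by
injectivity of `e`.  Conversely every `g : Fin x → Fin c` is `e ∘ (e.symm ∘ g)`.  Hence the two images coincide.
The lead uses this to transport designs along `finCongr : Fin (2^k + 2^k) ≃ Fin (2^(k+1))` in the induction on the
number of cores.

`stub_coreRelabel` is the registered stub text, verbatim.  Folklore-level; Mathlib only; no citations, no `def`s.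
-/

-- Sub = Summit single-conjunct layout: the duplicated namespace component is mandated by the tree.
set_option linter.dupNamespace false

open scoped BigOperators

namespace Summit.ValiantsHypothesis.ValiantsHypothesis.Theorems.NewtonUnitEquationsNewtonTauWeak

namespace CoreRelabelAux

/-- FIBRES UNDER RELABELLING: the fibre of `e ∘ f` over the relabelled core `e d` is the fibre of `f` over `d`
(injectivity of `e`). [folklore] -/
theorem filter_comp_eq {c c' x : ℕ} (e : Fin c' ≃ Fin c) (f : Fin x → Fin c') (d : Fin c') :
    (Finset.univ.filter fun u => e (f u) = e d) = Finset.univ.filter fun u => f u = d := by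
  simp only [EmbeddingLike.apply_eq_iff_eq]

/-- KEY COMPUTATION: the point of the relabelled configuration `e ∘ f` for the design `h`, read through `V`, is the
point of `f` for the relabelled design `d ↦ h (e d)` (reindex the sum over cores along `e`). [folklore] -/
theorem sum_comp_eq {c c' x : ℕ} (e : Fin c' ≃ Fin c) (V : Finset (Fin x))
    (h : Fin c → Finset (Fin x) → (Fin 2 →₀ ℕ)) (f : Fin x → Fin c') :
    (∑ d, h d (V ∩ Finset.univ.filter fun u => e (f u) = d)) =
      ∑ d, h (e d) (V ∩ Finset.univ.filter fun u => f u = d) := by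
  symm
  exact Fintype.sum_equiv e _ _ fun d => by rw [filter_comp_eq e f d]

end CoreRelabelAux

/-- **STUB P13 `stub_coreRelabel`** (registered signature, verbatim) — the cloud of a `c`-core design read through
`V` is invariant under relabelling the cores along an equivalence `e : Fin c' ≃ Fin c`: the configurations
`f : Fin x → Fin c'` of the relabelled design `d ↦ h (e d)` and the configurations `g : Fin x → Fin c` of `h` have
the same finite set of points (`f ↦ e ∘ f`, `g ↦ e.symm ∘ g`). [folklore] -/
theorem stub_coreRelabel (c c' x : ℕ) (e : Fin c' ≃ Fin c) (V : Finset (Fin x)) (h : Fin c → Finset (Fin x) → (Fin 2 →₀ ℕ)) :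
    (Finset.univ.image fun f : Fin x → Fin c' =>
          ∑ d, h (e d) (V ∩ Finset.univ.filter fun u => f u = d)) =
      (Finset.univ.image fun f : Fin x → Fin c =>
          ∑ d, h d (V ∩ Finset.univ.filter fun u => f u = d)) := by
  ext p
  simp only [Finset.mem_image, Finset.mem_univ, true_and]
  constructor
  · -- `f ↦ e ∘ f` has the same point
    rintro ⟨f, rfl⟩
    exact ⟨fun u => e (f u), CoreRelabelAux.sum_comp_eq e V h f⟩
  · -- `g = e ∘ (e.symm ∘ g)`
    rintro ⟨g, rfl⟩
    refine ⟨fun u => e.symm (g u), ?_⟩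
    rw [← CoreRelabelAux.sum_comp_eq e V h fun u => e.symm (g u)]
    simp only [Equiv.apply_symm_apply]

end Summit.ValiantsHypothesis.ValiantsHypothesis.Theorems.NewtonUnitEquationsNewtonTauWeak
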